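import Mathlib
import HarnessLib
import Literature.Algebra.Polynomial.ModularGcd
import Summits.ValiantsHypothesis.ValiantsHypothesis.Theorems.LacunarySymmetroidMatrixDescartesOsculationLawUniformAll

/-!
# ValiantsHypothesis / LacunarySymmetroid — crux `MatrixDescartes` (stmt-ValiantsHypothesis-18050, V1),
# line «osculation-law»: UNIFORM columns, part 7 — FINITENESS of the osculation set from a non-vanishing resultant

The general-position hypothesis `(osculationSet d S).Finite` of the line (used by `PeelInequalityAt` and `OsculationLawAt`) in
ALGEBRAIC currency: with the letter `P = Σ_k a_k(t) b^k ∈ ℝ[t][b]` and its bordered log-Hessian `HH ∈ ℝ[t][b]` (part 5,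
`OsculationUniform.eval_logHessian_sum`), if the resultant `Res_b(P, HH) ∈ ℝ[t]` (Mathlib's `Polynomial.resultant` over the
coefficient ring `ℝ[t]`) is not the zero polynomial and no fibre `P(t,·)` vanishes identically (`t > 0`), then the osculation set is
FINITE: its abscissae are roots of `lc_b P · Res_b(P, HH)` (elsewhere `P(t,·)`, `HH(t,·)` are coprime by von zur Gathen–Gerhard
Lemma 6.25, `Literature.Algebra.Polynomial.ModularGcd.map_resultant_eq_zero_iff_not_isCoprime` with `φ = evalRingHom t`), and each
fibre lies in the roots of `P(t,·) ≢ 0`.  `osc_finite_of_resultant_ne_zero` (abstract pair), `letter_osc_finite_of_resultant_ne_zero`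
(every splitting `(r,s)`, line vocabulary unfolded), `letter_osc_finite_of_resultant_ne_zero_top` (when the top cofactor sum `a_r = det G₂₂`
has no positive zero, e.g. `s = 0` where it is `1`).  Input (D2) of the `stub_recursion` general-position density discussion
(val-lit-p7 g13's sizing memo §4), currency-free half; the line-genericity half is not addressed here.

Honest framing: helper layer of an UNREGISTERED V1 law line; `stub_osculationLaw` (LAW), `stub_recursion`, `MatrixDescartes`, Conjecture B
and `VP ≠ VNP` are OPEN / NOT proved.  No definitions, no named facts; Mathlib + tree files + `Literature.Algebra.Polynomial.ModularGcd`.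
-/

-- `Summit.ValiantsHypothesis.ValiantsHypothesis.…` is the tree's mandated single-conjunct layout (Sub = Summit).
set_option linter.dupNamespace false

set_option maxRecDepth 100000

noncomputable section

namespace Summit.ValiantsHypothesis.ValiantsHypothesis.Theorems.LacunarySymmetroidMatrixDescartes

namespace OsculationUniform

open Polynomial Set
open scoped BigOperators Pointwise
open Literature.Algebra.Polynomial.ModularGcd

/-! ### Abstract pair -/

/-- **Finiteness from the resultant.**  `Res_b(P,Q) ≢ 0` and no identically vanishing fibre of `P` over `t > 0` ⇒ the common positive
zero set `{t > 0, b > 0, P(t,b) = Q(t,b) = 0}` is finite. [cite: GathenGerhard1999, Lemma 6.25] -/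
theorem osc_finite_of_resultant_ne_zero (P Q : ℝ[X][X]) (osc : Set (Fin 2 → ℝ))
    (hosc : ∀ p : Fin 2 → ℝ, p ∈ osc ↔ 0 < p 0 ∧ 0 < p 1 ∧ (P.map (evalRingHom (p 0))).IsRoot (p 1) ∧
      (Q.map (evalRingHom (p 0))).IsRoot (p 1))
    (hres : resultant P Q ≠ 0) (hvert : ∀ t : ℝ, 0 < t → P.map (evalRingHom t) ≠ 0) : osc.Finite := by
  classical
  have hP0 : P ≠ 0 := by
    intro h0
    exact hvert 1 one_pos (by rw [h0, Polynomial.map_zero])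
  set Pex : ℝ[X] := P.leadingCoeff * resultant P Q with hPex
  have hPex0 : Pex ≠ 0 := mul_ne_zero (leadingCoeff_ne_zero.2 hP0) hres
  -- abscissae are roots of `Pex`
  have habs : ∀ p ∈ osc, Pex.IsRoot (p 0) := by
    intro p hp
    obtain ⟨-, -, hProot, hQroot⟩ := (hosc p).1 hp
    by_contra hne
    rw [IsRoot, hPex, eval_mul] at hne
    have hlc : P.leadingCoeff.eval (p 0) ≠ 0 := fun h => hne (by rw [h, zero_mul])
    have hr : (resultant P Q).eval (p 0) ≠ 0 := fun h => hne (by rw [h, mul_zero])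
    have hcop : IsCoprime (P.map (evalRingHom (p 0))) (Q.map (evalRingHom (p 0))) := by
      by_contra hnc
      exact hr ((map_resultant_eq_zero_iff_not_isCoprime (evalRingHom (p 0)) P Q (Or.inl hlc)).2 hnc)
    obtain ⟨u, v, huv⟩ := hcop
    have := congr_arg (fun q => q.eval (p 1)) huv
    simp only [eval_add, eval_mul, hProot.eq_zero, hQroot.eq_zero, mul_zero, add_zero, eval_one] at this
    exact zero_ne_one this
  -- cover by a finite set
  set T : Finset ℝ := Pex.roots.toFinset with hT
  set F : Finset (Fin 2 → ℝ) :=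
    T.biUnion (fun t => ((P.map (evalRingHom t)).roots.toFinset).image (fun b => (![t, b] : Fin 2 → ℝ))) with hF
  refine (Finset.finite_toSet F).subset fun p hp => ?_
  obtain ⟨ht, -, hProot, -⟩ := (hosc p).1 hp
  rw [Finset.mem_coe, hF, Finset.mem_biUnion]
  refine ⟨p 0, by rw [hT, Multiset.mem_toFinset]; exact (mem_roots hPex0).2 (habs p hp), ?_⟩
  rw [Finset.mem_image]
  exact ⟨p 1, by rw [Multiset.mem_toFinset]; exact (mem_roots (hvert _ ht)).2 hProot, vec2_eq p⟩

/-! ### The letter of a symmetric block pencil, every splitting -/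

/-- **Finiteness of the osculation set from the resultant, every splitting `(r, s)`** (line vocabulary unfolded; `a_k` = the
cofactor sums of `OsculationLetter.insertionPoly_rank_card`; `HH` = the Hessian polynomial of `OsculationUniform.eval_logHessian_sum`).
[cite: GathenGerhard1999, Lemma 6.25] -/
theorem letter_osc_finite_of_resultant_ne_zero (r s K : ℕ) (d : Fin K → ℕ)
    (S : Fin K → Matrix (Fin r ⊕ Fin s) (Fin r ⊕ Fin s) ℝ) (c : ℕ → ℝ[X])
    (hc : c = fun k => ∑ U ∈ (Finset.univ.map Function.Embedding.inl : Finset (Fin r ⊕ Fin s)).powersetCard k,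
      (Matrix.of fun i j : Fin r ⊕ Fin s => if i ∈ U then (Pi.single i (1 : ℝ[X]) : Fin r ⊕ Fin s → ℝ[X]) j
        else (∑ l, (X : ℝ[X]) ^ d l • (S l).map Polynomial.C) i j).det)
    (hres : resultant (∑ k ∈ Finset.range (r + 1), C (c k) * X ^ k : ℝ[X][X])
      ((∑ k ∈ Finset.range (r + 1), C (X * derivative (X * derivative (c k))) * X ^ k : ℝ[X][X]) *
            (∑ k ∈ Finset.range (r + 1), C (C (k : ℝ) * c k) * X ^ k) ^ 2
          - 2 * (∑ k ∈ Finset.range (r + 1), C (C (k : ℝ) * (X * derivative (c k))) * X ^ k) *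
            (∑ k ∈ Finset.range (r + 1), C (X * derivative (c k)) * X ^ k) *
            (∑ k ∈ Finset.range (r + 1), C (C (k : ℝ) * c k) * X ^ k)
          + (∑ k ∈ Finset.range (r + 1), C (C (k : ℝ) * (C (k : ℝ) * c k)) * X ^ k) *
            (∑ k ∈ Finset.range (r + 1), C (X * derivative (c k)) * X ^ k) ^ 2) ≠ 0)
    (hvert : ∀ t : ℝ, 0 < t → (∑ k ∈ Finset.range (r + 1), C (c k) * X ^ k : ℝ[X][X]).map (evalRingHom t) ≠ 0) :
    {p : Fin 2 → ℝ | 0 < p 0 ∧ 0 < p 1 ∧ MvPolynomial.eval p (∑ l, (MvPolynomial.X (0 : Fin 2) : MvPolynomial (Fin 2) ℝ) ^ d l •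
              (S l).map (MvPolynomial.C : ℝ →+* MvPolynomial (Fin 2) ℝ)
            + (MvPolynomial.X (1 : Fin 2) : MvPolynomial (Fin 2) ℝ) •
              (Matrix.fromBlocks 1 0 0 0 : Matrix (Fin r ⊕ Fin s) (Fin r ⊕ Fin s) ℝ).map
                (MvPolynomial.C : ℝ →+* MvPolynomial (Fin 2) ℝ)).det = 0 ∧
      MvPolynomial.eval p
        (MvPolynomial.X 0 * MvPolynomial.pderiv 0 (MvPolynomial.X 0 * MvPolynomial.pderiv 0 (∑ l, (MvPolynomial.X (0 : Fin 2) : MvPolynomial (Fin 2) ℝ) ^ d l •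
              (S l).map (MvPolynomial.C : ℝ →+* MvPolynomial (Fin 2) ℝ)
            + (MvPolynomial.X (1 : Fin 2) : MvPolynomial (Fin 2) ℝ) •
              (Matrix.fromBlocks 1 0 0 0 : Matrix (Fin r ⊕ Fin s) (Fin r ⊕ Fin s) ℝ).map
                (MvPolynomial.C : ℝ →+* MvPolynomial (Fin 2) ℝ)).det)
            * (MvPolynomial.X 1 * MvPolynomial.pderiv 1 (∑ l, (MvPolynomial.X (0 : Fin 2) : MvPolynomial (Fin 2) ℝ) ^ d l •
              (S l).map (MvPolynomial.C : ℝ →+* MvPolynomial (Fin 2) ℝ)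
            + (MvPolynomial.X (1 : Fin 2) : MvPolynomial (Fin 2) ℝ) •
              (Matrix.fromBlocks 1 0 0 0 : Matrix (Fin r ⊕ Fin s) (Fin r ⊕ Fin s) ℝ).map
                (MvPolynomial.C : ℝ →+* MvPolynomial (Fin 2) ℝ)).det) ^ 2
          - 2 * (MvPolynomial.X 0 * MvPolynomial.pderiv 0 (MvPolynomial.X 1 * MvPolynomial.pderiv 1 (∑ l, (MvPolynomial.X (0 : Fin 2) : MvPolynomial (Fin 2) ℝ) ^ d l •
              (S l).map (MvPolynomial.C : ℝ →+* MvPolynomial (Fin 2) ℝ)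
            + (MvPolynomial.X (1 : Fin 2) : MvPolynomial (Fin 2) ℝ) •
              (Matrix.fromBlocks 1 0 0 0 : Matrix (Fin r ⊕ Fin s) (Fin r ⊕ Fin s) ℝ).map
                (MvPolynomial.C : ℝ →+* MvPolynomial (Fin 2) ℝ)).det))
            * (MvPolynomial.X 0 * MvPolynomial.pderiv 0 (∑ l, (MvPolynomial.X (0 : Fin 2) : MvPolynomial (Fin 2) ℝ) ^ d l •
              (S l).map (MvPolynomial.C : ℝ →+* MvPolynomial (Fin 2) ℝ)
            + (MvPolynomial.X (1 : Fin 2) : MvPolynomial (Fin 2) ℝ) •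
              (Matrix.fromBlocks 1 0 0 0 : Matrix (Fin r ⊕ Fin s) (Fin r ⊕ Fin s) ℝ).map
                (MvPolynomial.C : ℝ →+* MvPolynomial (Fin 2) ℝ)).det) * (MvPolynomial.X 1 * MvPolynomial.pderiv 1 (∑ l, (MvPolynomial.X (0 : Fin 2) : MvPolynomial (Fin 2) ℝ) ^ d l •
              (S l).map (MvPolynomial.C : ℝ →+* MvPolynomial (Fin 2) ℝ)
            + (MvPolynomial.X (1 : Fin 2) : MvPolynomial (Fin 2) ℝ) •
              (Matrix.fromBlocks 1 0 0 0 : Matrix (Fin r ⊕ Fin s) (Fin r ⊕ Fin s) ℝ).map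
                (MvPolynomial.C : ℝ →+* MvPolynomial (Fin 2) ℝ)).det)
          + MvPolynomial.X 1 * MvPolynomial.pderiv 1 (MvPolynomial.X 1 * MvPolynomial.pderiv 1 (∑ l, (MvPolynomial.X (0 : Fin 2) : MvPolynomial (Fin 2) ℝ) ^ d l •
              (S l).map (MvPolynomial.C : ℝ →+* MvPolynomial (Fin 2) ℝ)
            + (MvPolynomial.X (1 : Fin 2) : MvPolynomial (Fin 2) ℝ) •
              (Matrix.fromBlocks 1 0 0 0 : Matrix (Fin r ⊕ Fin s) (Fin r ⊕ Fin s) ℝ).map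
                (MvPolynomial.C : ℝ →+* MvPolynomial (Fin 2) ℝ)).det)
            * (MvPolynomial.X 0 * MvPolynomial.pderiv 0 (∑ l, (MvPolynomial.X (0 : Fin 2) : MvPolynomial (Fin 2) ℝ) ^ d l •
              (S l).map (MvPolynomial.C : ℝ →+* MvPolynomial (Fin 2) ℝ)
            + (MvPolynomial.X (1 : Fin 2) : MvPolynomial (Fin 2) ℝ) •
              (Matrix.fromBlocks 1 0 0 0 : Matrix (Fin r ⊕ Fin s) (Fin r ⊕ Fin s) ℝ).map
                (MvPolynomial.C : ℝ →+* MvPolynomial (Fin 2) ℝ)).det) ^ 2) = 0}.Finite := by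
  have hΦ := OsculationLetter.insertionPoly_rank_card r s d S
  refine osc_finite_of_resultant_ne_zero _ _ _ (fun p => ?_) hres hvert
  rw [Set.mem_setOf_eq, eval_logHessian_sum c r _ (by rw [hΦ, hc]) p, hΦ]
  subst hc
  rw [eval_sum_letter, ← eval_map_PP]
  exact Iff.rfl

/-- The fibre condition holds as soon as the TOP cofactor sum `a_r = det G₂₂` (`OsculationLetter.coeff_top`) has no positive zero — in
particular at the splitting `s = 0`, where it is the determinant of the empty pencil, `1`. [folklore] -/
theorem map_PP_ne_zero_of_top (c : ℕ → ℝ[X]) (r : ℕ) (t : ℝ) (htop : (c r).eval t ≠ 0) :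
    (∑ k ∈ Finset.range (r + 1), C (c k) * X ^ k : ℝ[X][X]).map (evalRingHom t) ≠ 0 := by
  intro h0
  have := congr_arg (fun q : ℝ[X] => q.coeff r) h0
  simp only [Polynomial.map_sum, Polynomial.map_mul, Polynomial.map_pow, map_X, map_C, coe_evalRingHom, finsetSum_coeff,
    coeff_C_mul_X_pow, coeff_zero] at this
  rw [Finset.sum_ite_eq (Finset.range (r + 1)) r, if_pos (Finset.mem_range.2 (Nat.lt_succ_self r))] at this
  exact htop this

/-- At `s = 0` the top cofactor sum is `1` (the pencil of lower-right blocks is a `0 × 0` matrix). [folklore] -/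
theorem top_coeff_eq_one_of_zero (r K : ℕ) (d : Fin K → ℕ) (S : Fin K → Matrix (Fin r ⊕ Fin 0) (Fin r ⊕ Fin 0) ℝ) :
    ∑ U ∈ (Finset.univ.map Function.Embedding.inl : Finset (Fin r ⊕ Fin 0)).powersetCard r,
        (Matrix.of fun i j : Fin r ⊕ Fin 0 => if i ∈ U then (Pi.single i (1 : ℝ[X]) : Fin r ⊕ Fin 0 → ℝ[X]) j
          else (∑ l, (X : ℝ[X]) ^ d l • (S l).map Polynomial.C) i j).det = 1 := by
  rw [OsculationLetter.coeff_top r 0 d S]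
  exact Matrix.det_isEmpty

end OsculationUniform

end Summit.ValiantsHypothesis.ValiantsHypothesis.Theorems.LacunarySymmetroidMatrixDescartes
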